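import Summits.CriticalPhenomena.SAWScalingLimit.Theorems.SAWTotalPositivityCriticalBubbleBoundDockingDefs

/-!
# Objects of the JOIN-MASS programme of line `docking-census-joining` for the crux
`SAWTotalPositivity.CriticalBubbleBound` (stmt-CriticalPhenomena-7117; lead prover c6, crux protocol)

The docking line's landed ledger `Docking.stub_ledgerBootstrap` (θ − 1 = κ + π as a theorem about an
ARBITRARY nonnegative sequence) is fed, in this programme, with the exponents that polygon joining à la
Madras–Hammond provides in `x_c`-MASS form (Hammond, *An upper bound on the number of self-avoiding
polygons via joining*, Ann. Probab. 46 (2018), §4; the crux idea card `join-mass-bootstrap`): docking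
ENTROPY `κ = 3/2` in the unrooted normalisation (two tall polygon classes of size `≍ 2^i` are globally
Madras-joinable at `≳ 2^{i/2}` vertical offsets, Lemma 4.11) and RARITY `π = 0` for GLOBAL join plaquettes
(Prop. 4.5). This file only DEFINES the finite combinatorial objects the programme's stub files speak
about; no statement of the programme is asserted here.

* `LexPos`, `lexRooted n` — LEX-ROOTED rooted polygons: `χ ∈ Zd.sawFun 2 n e₀` all of whose vertices are
  lexicographically (row first) `≥ 0`, i.e. the root `0` is the lowest-then-leftmost vertex of `P(χ)`; exactly
  one per translation class of `(n+1)`-edge self-avoiding polygons (the class model of this programme);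
* `cterm n = #lexRooted n · x_c^{n+1}` (critical mass of the `(n+1)`-edge classes), `joinShift = 17` and the
  shifted sequence `jterm` (the Madras join adds `16` edges, so in walk length `j, m ↦ j + m + 17`: the shift
  makes block `B_i × B_i` land in `B_{i+1}` exactly);
* `xs, ys, xmax, xmin, ymax, ymin, height, width, rightCol, tipRow, esRow, esVertex, esIdx` — corners of
  `P(χ)` (Hammond §2.0.3 with the anchor moved from `NE` to the lex-minimal root);
* `IsTall`, `IsLeftPoly` — Hammond's right/left polygon classes (Def. 4.8, mirrored: tip in the UPPER half);
* `IsJoinPlaq E q`, `flipH E q`, `IsGlobalJoin n χ q`, `gjoins n χ` — join plaquettes with lower-left corner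
  `q` (horizontal sides in `E`, vertical sides not), the un-joining flip, GLOBAL join plaquettes (the flip
  splits `P(χ)` into vertex-disjoint polygons `E₁ ∋ 0` and `E₂ ⊇` all rightmost vertices; Def. 4.4) and
  their set;
* `Urar i` — the RARITY-side mass `Σ_{targets of scale i+1} |gjoins| x_c^{|J|}` of the ledger.

Sources: A. Hammond, Ann. Probab. 46 (2018) 175–206 = arXiv:1808.09032, §2.0.3, Def. 2.3, Def. 4.4, Def. 4.8;
N. Madras, G. Slade, *The Self-Avoiding Walk* (1993), Def. 3.2.1–3.2.2.
-/

noncomputable section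

open Literature.Probability.LatticeModels
open Literature.Probability.RandomPlanarGeometry Literature.Probability.RandomPlanarGeometry.SAW
open scoped BigOperators
open Summit.CriticalPhenomena.SAWScalingLimit.Theorems.CriticalBubbleBound.Negative (e₀)
open Summit.CriticalPhenomena.SAWScalingLimit.Theorems.CriticalBubbleBound.Docking

namespace Summit.CriticalPhenomena.SAWScalingLimit.Theorems.CriticalBubbleBound.Join

/-! ## Lex-rooted polygon classes and their critical masses -/

/-- Lexicographic nonnegativity, ROW FIRST: `x` lies strictly above row `0`, or on row `0` weakly
right of the origin. [cite: Hammond2015SAPJoining, §2.0.3 (lexicographic corners WS, EN)] -/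
def LexPos (x : Site 2) : Prop := 0 < x 1 ∨ (x 1 = 0 ∧ 0 ≤ x 0)

/-- `LexPos` is decidable. [folklore] -/
instance (x : Site 2) : Decidable (LexPos x) := by unfold LexPos; infer_instance

open Classical in
/-- LEX-ROOTED rooted polygons of walk length `n`: the `χ ∈ Zd.sawFun 2 n e₀` (an `n`-step SAW
`0 → e₀`, closed up by the root edge `{e₀, 0}` into an `(n+1)`-edge polygon) all of whose vertices are
lexicographically `≥ 0` — the root `0` is the lowest-then-leftmost vertex. Every translation class of
`(n+1)`-edge self-avoiding polygons has exactly one such representative (its lowest-leftmost vertex has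
its two polygon edges pointing east and north). [cite: MadrasSlade1993, Definition 3.2.2] -/
def lexRooted (n : ℕ) : Finset (ℕ → Site 2) :=
  (Zd.sawFun 2 n e₀).filter fun χ => ∀ m ≤ n, LexPos (χ m)

/-- Class mass at walk length `n`: `cterm n = #lexRooted n · x_c^{n+1}` (an `(n+1)`-edge polygon
weighs `x_c^{n+1}`). [cite: MadrasSlade1993, Definition 3.2.2] -/
def cterm (n : ℕ) : ℝ := ((lexRooted n).card : ℝ) * criticalFugacity ^ (n + 1)

/-- The length shift of the Madras join in walk length: joining classes of walk lengths `j` and `m`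
(polygons with `j+1` and `m+1` edges) gives a polygon with `(j+1)+(m+1)+16` edges, walk length
`j + m + 17`. [cite: Hammond2015SAPJoining, Definition 4.3] -/
def joinShift : ℕ := 17

/-- The SHIFTED class sequence fed to the ledger: `jterm n = cterm (n - 17)` for `n ≥ 17`, else `0`.
With this shift the join maps the dyadic block `B_i × B_i` into `B_{i+1}` exactly. [folklore] -/
def jterm (n : ℕ) : ℝ := if joinShift ≤ n then cterm (n - joinShift) else 0

/-! ## Corners of a rooted polygon (anchor at the root) -/

/-- Abscissae of the vertices `χ 0, …, χ n`. [cite: Hammond2015SAPJoining, §2.0.3] -/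
def xs (n : ℕ) (χ : ℕ → Site 2) : Finset ℤ := (Finset.range (n + 1)).image fun i => χ i 0

/-- Ordinates of the vertices `χ 0, …, χ n`. [cite: Hammond2015SAPJoining, §2.0.3] -/
def ys (n : ℕ) (χ : ℕ → Site 2) : Finset ℤ := (Finset.range (n + 1)).image fun i => χ i 1

/-- `xs` is nonempty. [folklore] -/
theorem xs_nonempty (n : ℕ) (χ : ℕ → Site 2) : (xs n χ).Nonempty :=
  ⟨χ 0 0, Finset.mem_image.2 ⟨0, Finset.mem_range.2 (Nat.succ_pos n), rfl⟩⟩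

/-- `ys` is nonempty. [folklore] -/
theorem ys_nonempty (n : ℕ) (χ : ℕ → Site 2) : (ys n χ).Nonempty :=
  ⟨χ 0 1, Finset.mem_image.2 ⟨0, Finset.mem_range.2 (Nat.succ_pos n), rfl⟩⟩

/-- `xmax` — the maximal abscissa of a vertex. [cite: Hammond2015SAPJoining, §2.0.3] -/
def xmax (n : ℕ) (χ : ℕ → Site 2) : ℤ := (xs n χ).max' (xs_nonempty n χ)

/-- `xmin` — the minimal abscissa of a vertex. [cite: Hammond2015SAPJoining, §2.0.3] -/
def xmin (n : ℕ) (χ : ℕ → Site 2) : ℤ := (xs n χ).min' (xs_nonempty n χ)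

/-- `ymax` — the maximal ordinate of a vertex. [cite: Hammond2015SAPJoining, §2.0.3] -/
def ymax (n : ℕ) (χ : ℕ → Site 2) : ℤ := (ys n χ).max' (ys_nonempty n χ)

/-- `ymin` — the minimal ordinate of a vertex (`0` for lex-rooted polygons). [cite: Hammond2015SAPJoining, §2.0.3] -/
def ymin (n : ℕ) (χ : ℕ → Site 2) : ℤ := (ys n χ).min' (ys_nonempty n χ)

/-- Height `h = ymax - ymin`. [cite: Hammond2015SAPJoining, §2.0.3] -/
def height (n : ℕ) (χ : ℕ → Site 2) : ℤ := ymax n χ - ymin n χ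

/-- Width `w = xmax - xmin`. [cite: Hammond2015SAPJoining, §2.0.3] -/
def width (n : ℕ) (χ : ℕ → Site 2) : ℤ := xmax n χ - xmin n χ

/-- Every vertex abscissa is at most `xmax`. [folklore] -/
theorem apply_le_xmax {n : ℕ} (χ : ℕ → Site 2) {i : ℕ} (hi : i ≤ n) : χ i 0 ≤ xmax n χ :=
  Finset.le_max' (xs n χ) (χ i 0) (Finset.mem_image.2 ⟨i, Finset.mem_range.2 (Nat.lt_succ_of_le hi), rfl⟩)

/-- `xmin` is at most every vertex abscissa. [folklore] -/
theorem xmin_le_apply {n : ℕ} (χ : ℕ → Site 2) {i : ℕ} (hi : i ≤ n) : xmin n χ ≤ χ i 0 :=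
  Finset.min'_le _ _ (Finset.mem_image.2 ⟨i, Finset.mem_range.2 (Nat.lt_succ_of_le hi), rfl⟩)

/-- Every vertex ordinate is at most `ymax`. [folklore] -/
theorem apply_le_ymax {n : ℕ} (χ : ℕ → Site 2) {i : ℕ} (hi : i ≤ n) : χ i 1 ≤ ymax n χ :=
  Finset.le_max' (ys n χ) (χ i 1) (Finset.mem_image.2 ⟨i, Finset.mem_range.2 (Nat.lt_succ_of_le hi), rfl⟩)

/-- `ymin` is at most every vertex ordinate. [folklore] -/
theorem ymin_le_apply {n : ℕ} (χ : ℕ → Site 2) {i : ℕ} (hi : i ≤ n) : ymin n χ ≤ χ i 1 :=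
  Finset.min'_le _ _ (Finset.mem_image.2 ⟨i, Finset.mem_range.2 (Nat.lt_succ_of_le hi), rfl⟩)

/-- `xmax` is attained by a vertex. [folklore] -/
theorem exists_apply_eq_xmax (n : ℕ) (χ : ℕ → Site 2) : ∃ i ≤ n, χ i 0 = xmax n χ := by
  obtain ⟨i, hi, h⟩ := Finset.mem_image.1 (Finset.max'_mem (xs n χ) (xs_nonempty n χ))
  exact ⟨i, Nat.lt_succ_iff.1 (Finset.mem_range.1 hi), h⟩

/-- `ymax` is attained by a vertex. [folklore] -/
theorem exists_apply_eq_ymax (n : ℕ) (χ : ℕ → Site 2) : ∃ i ≤ n, χ i 1 = ymax n χ := by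
  obtain ⟨i, hi, h⟩ := Finset.mem_image.1 (Finset.max'_mem (ys n χ) (ys_nonempty n χ))
  exact ⟨i, Nat.lt_succ_iff.1 (Finset.mem_range.1 hi), h⟩

/-- `ymin` is attained by a vertex. [folklore] -/
theorem exists_apply_eq_ymin (n : ℕ) (χ : ℕ → Site 2) : ∃ i ≤ n, χ i 1 = ymin n χ := by
  obtain ⟨i, hi, h⟩ := Finset.mem_image.1 (Finset.min'_mem (ys n χ) (ys_nonempty n χ))
  exact ⟨i, Nat.lt_succ_iff.1 (Finset.mem_range.1 hi), h⟩

open Classical in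
/-- The RIGHTMOST vertices of `P(χ)` (the column `x = xmax`). [cite: Hammond2015SAPJoining, Definition 4.4] -/
def rightCol (n : ℕ) (χ : ℕ → Site 2) : Finset (Site 2) := (verts n χ).filter fun v => v 0 = xmax n χ

/-- Membership in `rightCol`. [folklore] -/
theorem mem_rightCol {n : ℕ} {χ : ℕ → Site 2} {v : Site 2} :
    v ∈ rightCol n χ ↔ v ∈ verts n χ ∧ v 0 = xmax n χ := by
  classical
  exact Finset.mem_filter

/-- The rightmost column is nonempty. [folklore] -/
theorem rightCol_nonempty (n : ℕ) (χ : ℕ → Site 2) : (rightCol n χ).Nonempty := by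
  obtain ⟨i, hi, h⟩ := exists_apply_eq_xmax n χ
  exact ⟨χ i, mem_rightCol.2 ⟨Finset.mem_image.2 ⟨i, Finset.mem_range.2 (Nat.lt_succ_of_le hi), rfl⟩, h⟩⟩

/-- `tipRow` — the row of the HIGHEST rightmost vertex (Hammond's right tip, mirrored because the
anchor of this programme is the lowest-leftmost vertex instead of `NE`). [cite: Hammond2015SAPJoining, Definition 4.8] -/
def tipRow (n : ℕ) (χ : ℕ → Site 2) : ℤ :=
  ((rightCol n χ).image fun v => v 1).max' ((rightCol_nonempty n χ).image _)

/-- `esRow` — the row of the LOWEST rightmost vertex `ES(P(χ))`. [cite: Hammond2015SAPJoining, §2.0.3] -/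
def esRow (n : ℕ) (χ : ℕ → Site 2) : ℤ :=
  ((rightCol n χ).image fun v => v 1).min' ((rightCol_nonempty n χ).image _)

/-- `ES(P(χ))` — the lowest among the rightmost vertices. [cite: Hammond2015SAPJoining, §2.0.3] -/
def esVertex (n : ℕ) (χ : ℕ → Site 2) : Site 2 := ![xmax n χ, esRow n χ]

/-- `ES` is a rightmost vertex. [folklore] -/
theorem esVertex_mem_rightCol (n : ℕ) (χ : ℕ → Site 2) : esVertex n χ ∈ rightCol n χ := by
  obtain ⟨v, hv, hv1⟩ := Finset.mem_image.1
    (Finset.min'_mem ((rightCol n χ).image fun v => v 1) ((rightCol_nonempty n χ).image _))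
  have hv0 := (mem_rightCol.1 hv).2
  have : esVertex n χ = v := by
    ext j; fin_cases j
    · simp [esVertex, hv0]
    · simp [esVertex, esRow, ← hv1]
  rw [this]; exact hv

/-- `ES` is a vertex: `∃ i ≤ n, χ i = ES`. [folklore] -/
theorem exists_apply_eq_esVertex (n : ℕ) (χ : ℕ → Site 2) : ∃ i, i ≤ n ∧ χ i = esVertex n χ := by
  obtain ⟨i, hi, h⟩ := Finset.mem_image.1 (mem_rightCol.1 (esVertex_mem_rightCol n χ)).1
  exact ⟨i, Nat.lt_succ_iff.1 (Finset.mem_range.1 hi), h⟩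

open Classical in
/-- `esIdx` — the (first) time at which `χ` visits `ES(P(χ))`; the arcs `χ[0, esIdx]` (root → ES) and
`χ[esIdx, n]` + root edge (ES → root) are the two arcs of Hammond's Lemma 4.7. [cite: Hammond2015SAPJoining, Lemma 4.7] -/
def esIdx (n : ℕ) (χ : ℕ → Site 2) : ℕ := Nat.find (exists_apply_eq_esVertex n χ)

/-- Specification of `esIdx`. [folklore] -/
theorem esIdx_spec (n : ℕ) (χ : ℕ → Site 2) : esIdx n χ ≤ n ∧ χ (esIdx n χ) = esVertex n χ := by
  classical
  exact Nat.find_spec (exists_apply_eq_esVertex n χ)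

/-! ## Left and right polygon classes (Hammond Def. 4.8, anchor at the bottom) -/

/-- TALL: width at most height (then `(h+1)² ≥ #vertices`, so `h ≳ √n`); Hammond's right polygons.
[cite: Hammond2015SAPJoining, Definition 4.8] -/
def IsTall (n : ℕ) (χ : ℕ → Site 2) : Prop := width n χ ≤ height n χ

/-- LEFT polygons: tall, and the highest rightmost vertex lies in the upper half,
`2 · tipRow ≥ ymin + ymax` (mirror image of Hammond's `y(righttip) ≤ (ymin + ymax)/2`, since the
anchor here is the lowest vertex). [cite: Hammond2015SAPJoining, Definition 4.8] -/
def IsLeftPoly (n : ℕ) (χ : ℕ → Site 2) : Prop := IsTall n χ ∧ ymin n χ + ymax n χ ≤ 2 * tipRow n χ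

/-! ## Join plaquettes, the un-joining flip, global join plaquettes -/

/-- `P` (the unit square with lower-left corner `q`) is a JOIN PLAQUETTE of the edge set `E`: `E`
contains its two horizontal sides `{q, q+e₀}`, `{q+e₁, q+e₀+e₁}` and neither vertical side.
[cite: Hammond2015SAPJoining, Definition 2.3] -/
def IsJoinPlaq (E : Finset (Sym2 (Site 2))) (q : Site 2) : Prop :=
  s(q, q + e₀) ∈ E ∧ s(q + e₁, q + e₀ + e₁) ∈ E ∧ s(q, q + e₁) ∉ E ∧ s(q + e₀, q + e₀ + e₁) ∉ E

/-- The un-joining flip `E Δ P`: remove the two horizontal sides of the plaquette at `q`, add the two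
vertical ones (for a join plaquette of a polygon this yields two disjoint polygons).
[cite: Hammond2015SAPJoining, Definition 2.3] -/
def flipH (E : Finset (Sym2 (Site 2))) (q : Site 2) : Finset (Sym2 (Site 2)) :=
  insert s(q, q + e₁) (insert s(q + e₀, q + e₀ + e₁) ((E.erase s(q, q + e₀)).erase s(q + e₁, q + e₀ + e₁)))

/-- GLOBAL JOIN PLAQUETTE of the lex-rooted polygon `P(χ)` at `q` (Hammond Def. 4.4 with the anchor at
the root): a join plaquette whose flip splits `P(χ)` into two vertex-disjoint polygons `E₁`, `E₂` with the
root `0` on `E₁` and EVERY rightmost vertex of `P(χ)` on `E₂`. [cite: Hammond2015SAPJoining, Definition 4.4] -/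
def IsGlobalJoin (n : ℕ) (χ : ℕ → Site 2) (q : Site 2) : Prop :=
  IsJoinPlaq (pedges n χ) q ∧
    ∃ E₁ E₂ : Finset (Sym2 (Site 2)),
      IsPolygon (zdGraph 2) E₁ ∧ IsPolygon (zdGraph 2) E₂ ∧
      (∀ x : Site 2, (∃ e ∈ E₁, x ∈ e) → (∃ e ∈ E₂, x ∈ e) → False) ∧
      E₁ ∪ E₂ = flipH (pedges n χ) q ∧
      (∃ e ∈ E₁, (0 : Site 2) ∈ e) ∧
      ∀ v ∈ rightCol n χ, ∃ e ∈ E₂, v ∈ e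

open Classical in
/-- The set of (lower-left corners of) global join plaquettes of `P(χ)` (`GJ_φ`; a corner of a join
plaquette is a vertex, so filtering over `verts` loses nothing). [cite: Hammond2015SAPJoining, Definition 4.4] -/
def gjoins (n : ℕ) (χ : ℕ → Site 2) : Finset (Site 2) := (verts n χ).filter (IsGlobalJoin n χ)

/-- RARITY-side mass of the ledger at scale `i`: over the targets of the join (shifted index
`n ∈ B_{i+1}`, i.e. classes of walk length `n - 17`), the number of global join plaquettes times the
class weight: `U_i = Σ_{n ∈ B_{i+1}, n ≥ 17} Σ_{χ ∈ lexRooted (n-17)} |gjoins| · x_c^{n-17+1}`.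
[cite: Hammond2015SAPJoining, Proposition 4.5] -/
def Urar (i : ℕ) : ℝ :=
  ∑ n ∈ block (i + 1), if joinShift ≤ n then
    ∑ χ ∈ lexRooted (n - joinShift),
      ((gjoins (n - joinShift) χ).card : ℝ) * criticalFugacity ^ (n - joinShift + 1) else 0

/-! ## Elementary API -/

/-- Membership in `lexRooted`. [folklore] -/
theorem mem_lexRooted {n : ℕ} {χ : ℕ → Site 2} :
    χ ∈ lexRooted n ↔ χ ∈ Zd.sawFun 2 n e₀ ∧ ∀ m ≤ n, LexPos (χ m) := by
  classical
  exact Finset.mem_filter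

/-- Lex-rooted polygons are rooted polygons. [folklore] -/
theorem lexRooted_subset (n : ℕ) : lexRooted n ⊆ Zd.sawFun 2 n e₀ := fun _ h => (mem_lexRooted.1 h).1

/-- All vertices of a lex-rooted polygon have nonnegative ordinate. [folklore] -/
theorem apply_one_nonneg_of_mem_lexRooted {n : ℕ} {χ : ℕ → Site 2} (h : χ ∈ lexRooted n) {m : ℕ}
    (hm : m ≤ n) : 0 ≤ χ m 1 := by
  rcases (mem_lexRooted.1 h).2 m hm with h1 | ⟨h1, -⟩
  · exact h1.le
  · exact h1.ge

/-- Class masses are nonnegative (registered infrastructure sub-goal of the programme, carried by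
this shared definitions file). [folklore] -/
theorem cterm_nonneg : ∀ n : ℕ, 0 ≤ cterm n := fun n =>
  mul_nonneg (Nat.cast_nonneg _) (pow_nonneg criticalFugacity_pos_lt_one'.1.le (n + 1))

/-- The shifted sequence is nonnegative. [folklore] -/
theorem jterm_nonneg (n : ℕ) : 0 ≤ jterm n := by
  unfold jterm
  split_ifs
  · exact cterm_nonneg _
  · exact le_rfl

/-- Unfolding `jterm` above the shift. [folklore] -/
theorem jterm_of_le {n : ℕ} (h : joinShift ≤ n) : jterm n = cterm (n - joinShift) := by
  rw [jterm, if_pos h]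

/-- Unfolding `jterm` below the shift. [folklore] -/
theorem jterm_of_lt {n : ℕ} (h : n < joinShift) : jterm n = 0 := by
  rw [jterm, if_neg (not_le.2 h)]

/-- The rarity-side masses are nonnegative. [folklore] -/
theorem Urar_nonneg (i : ℕ) : 0 ≤ Urar i := by
  refine Finset.sum_nonneg fun n _ => ?_
  split_ifs
  · exact Finset.sum_nonneg fun χ _ =>
      mul_nonneg (Nat.cast_nonneg _) (pow_nonneg criticalFugacity_pos_lt_one'.1.le _)
  · exact le_rfl

/-- Membership in `gjoins`. [folklore] -/
theorem mem_gjoins {n : ℕ} {χ : ℕ → Site 2} {q : Site 2} :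
    q ∈ gjoins n χ ↔ q ∈ verts n χ ∧ IsGlobalJoin n χ q := by
  classical
  exact Finset.mem_filter

/-- Every rightmost vertex lies weakly below the tip row. [folklore] -/
theorem le_tipRow {n : ℕ} {χ : ℕ → Site 2} {v : Site 2} (hv : v ∈ rightCol n χ) : v 1 ≤ tipRow n χ := by
  unfold tipRow
  exact Finset.le_max' _ _ (Finset.mem_image_of_mem (fun w : Site 2 => w 1) hv)

/-- The tip row is the ordinate of a rightmost vertex. [folklore] -/
theorem exists_eq_tipRow (n : ℕ) (χ : ℕ → Site 2) : ∃ v ∈ rightCol n χ, v 1 = tipRow n χ := by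
  obtain ⟨v, hv, h⟩ := Finset.mem_image.1
    (Finset.max'_mem ((rightCol n χ).image fun w : Site 2 => w 1) ((rightCol_nonempty n χ).image _))
  exact ⟨v, hv, h⟩

/-- Every rightmost vertex lies weakly above the row of `ES`. [folklore] -/
theorem esRow_le {n : ℕ} {χ : ℕ → Site 2} {v : Site 2} (hv : v ∈ rightCol n χ) : esRow n χ ≤ v 1 := by
  unfold esRow
  exact Finset.min'_le _ _ (Finset.mem_image_of_mem (fun w : Site 2 => w 1) hv)

/-- The row of `ES` is the ordinate of a rightmost vertex. [folklore] -/
theorem exists_eq_esRow (n : ℕ) (χ : ℕ → Site 2) : ∃ v ∈ rightCol n χ, v 1 = esRow n χ := by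
  obtain ⟨v, hv, h⟩ := Finset.mem_image.1
    (Finset.min'_mem ((rightCol n χ).image fun w : Site 2 => w 1) ((rightCol_nonempty n χ).image _))
  exact ⟨v, hv, h⟩

end Summit.CriticalPhenomena.SAWScalingLimit.Theorems.CriticalBubbleBound.Join

end
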